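import Mathlib
import Summits.Ventures.HodgeRepro2.T5IsotypicHom
import Summits.Ventures.HodgeRepro2.T5IsotypicProduct

/-!
# The `K`-level isotypic decomposition over an algebraically closed field, unconditionally

Blind cell `pub-hodge-repro2`, seat p8 (gen 5), Tier-5 kernel support.  `T5IsotypicHom`
(p392230) and `T5IsotypicProduct` (p392441) take the Schur hypothesis `End_R(N) = k` as an
explicit argument.  Over an ALGEBRAICALLY CLOSED field a finite-dimensional simple module
satisfies it automatically — Mathlib's `IsSimpleModule.algebraMap_end_bijective_of_isAlgClosed`
(Schur's lemma for finite-dimensional simple modules over a `k`-algebra; equivalently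
`T5SchurEigenvalue.exists_smul_eq_of_stable` with the stable subspace `W = N` itself).  This
file records the discharge and the resulting unconditional forms:

* `schur_of_finiteDimensional` — `End_R(N) = k` for a finite-dimensional simple `N` over an
  algebraically closed `k`;
* `evEquiv` — a semisimple `N`-isotypic module `T` is `N ⊗[k] Hom_R(N, T)` (MVW III.3);
* `isotypicQuotEquiv` — `S[N] = S ⧸ ⋂ Ker f` is `N ⊗[k] Hom_R(N, S[N])` (MVW III.3 + III.5),
  both with no Schur hypothesis left; `…_complex` instances over `ℂ`.

In the record (route/T5-N3-route-2.md §N3.10.3): `k = ℂ`, `R = H(G₁, K)` (the Hecke algebra of a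
compact open `K`), `N = π₁^K` (finite-dimensional by admissibility, simple by irreducibility of
`π₁`), `S = ω^K`.  What stays prose: the identifications just listed and the passage from the
`K`-level to the smooth representation.

README §8(d): uses an L-value-free non-vanishing device: NO.
-/

noncomputable section

namespace Summit.Ventures.HodgeRepro2.T5IsotypicQuotAlgClosed

open TensorProduct

variable {k R N : Type*} [Field k] [IsAlgClosed k] [Ring R] [Algebra k R] [AddCommGroup N]
  [Module R N] [Module k N] [IsScalarTower k R N] [IsSimpleModule R N] [FiniteDimensional k N]

/-- **Finite-dimensional Schur** (Mathlib's `IsSimpleModule.algebraMap_end_bijective_of_isAlgClosed`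
in the pointwise form used by `T5IsotypicHom` / `T5IsotypicProduct`): a finite-dimensional simple
module over an algebraically closed field has only scalar endomorphisms. -/
theorem schur_of_finiteDimensional (φ : N →ₗ[R] N) : ∃ c : k, ∀ x, φ x = c • x := by
  obtain ⟨c, hc⟩ := (IsSimpleModule.algebraMap_end_bijective_of_isAlgClosed k (A := R) (V := N)).2 φ
  exact ⟨c, fun x => by rw [← hc, Module.algebraMap_end_apply]⟩

section Isotypic

universe u

variable {T : Type u} [AddCommGroup T] [Module R T] [Module k T] [IsScalarTower k R T]

/-- **MVW III.3, unconditional over an algebraically closed field.** A semisimple module isotypic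
of type a finite-dimensional simple `N` is `N ⊗[k] Hom_R(N, T)` by evaluation. -/
def evEquiv [IsSemisimpleModule R T] (hT : IsIsotypicOfType R T N) :
    N ⊗[k] (N →ₗ[R] T) ≃ₗ[R] T :=
  haveI := IsSimpleModule.nontrivial R N
  T5IsotypicHom.evEquiv schur_of_finiteDimensional hT

/-- `evEquiv (n ⊗ f) = f n`. -/
theorem evEquiv_tmul [IsSemisimpleModule R T] (hT : IsIsotypicOfType R T N) (n : N)
    (f : N →ₗ[R] T) : evEquiv hT (n ⊗ₜ[k] f) = f n := rfl

end Isotypic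

section Quotient

variable (R N) (S : Type*) [AddCommGroup S] [Module R S] [Module k S] [IsScalarTower k R S]

/-- **MVW III.3 + III.5 at the `K`-level, unconditional over an algebraically closed field.**
`S[N] = S ⧸ ⋂_{f : S → N} Ker f` is `N ⊗[k] Hom_R(N, S[N])`. -/
def isotypicQuotEquiv :
    N ⊗[k] (N →ₗ[R] (S ⧸ T5IsotypicProduct.isotypicKer R N S)) ≃ₗ[R]
      (S ⧸ T5IsotypicProduct.isotypicKer R N S) :=
  haveI := IsSimpleModule.nontrivial R N
  T5IsotypicProduct.isotypicQuotEquiv k R N S schur_of_finiteDimensional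

/-- `isotypicQuotEquiv (n ⊗ f) = f n`. -/
theorem isotypicQuotEquiv_tmul (n : N) (f : N →ₗ[R] (S ⧸ T5IsotypicProduct.isotypicKer R N S)) :
    isotypicQuotEquiv R N S (n ⊗ₜ[k] f) = f n := rfl

end Quotient

end Summit.Ventures.HodgeRepro2.T5IsotypicQuotAlgClosed

namespace Summit.Ventures.HodgeRepro2.T5IsotypicQuotAlgClosed

open TensorProduct

section Complex

variable {R N : Type*} [Ring R] [Algebra ℂ R] [AddCommGroup N] [Module R N] [Module ℂ N]
  [IsScalarTower ℂ R N] [IsSimpleModule R N] [FiniteDimensional ℂ N]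

/-- Finite-dimensional Schur over `ℂ`. -/
theorem schur_of_finiteDimensional_complex (φ : N →ₗ[R] N) : ∃ c : ℂ, ∀ x, φ x = c • x :=
  schur_of_finiteDimensional φ

/-- MVW III.3 + III.5 at the `K`-level over `ℂ`: `S[N] ≃ N ⊗ Hom_R(N, S[N])` for a
finite-dimensional simple `N`. -/
def isotypicQuotEquivComplex (S : Type*) [AddCommGroup S] [Module R S] [Module ℂ S]
    [IsScalarTower ℂ R S] :
    N ⊗[ℂ] (N →ₗ[R] (S ⧸ T5IsotypicProduct.isotypicKer R N S)) ≃ₗ[R]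
      (S ⧸ T5IsotypicProduct.isotypicKer R N S) :=
  isotypicQuotEquiv R N S

end Complex

end Summit.Ventures.HodgeRepro2.T5IsotypicQuotAlgClosed

end
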